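import Mathlib
import Summits.Ventures.PercRepro2.Defs
import Summits.Ventures.PercRepro2.Independence
import Summits.Ventures.PercRepro2.Harris
import Summits.Ventures.PercRepro2.Graph
import Summits.Ventures.PercRepro2.Exploration
import Summits.Ventures.PercRepro2.Events
import Summits.Ventures.PercRepro2.RBDefs

/-!
# The «w ∈ C_s» split of row 2′RB and candidate row 2′RB-CLUB (blind cell PercRepro2, mine-a g7;
MINE-A.md §43–§45, proofs/MINEA-CLUB.md)

Setting as in `RBDefs`: roots `s, t`, `Q = {s ↮ t}` (`Qst`), third vertex `w`, markers `b, o`,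
`bL = {b ↔ s}`, `oL = {o ↔ s}`. Let `M = {s ↔ w} = {w ∈ C_s}` (`connEvent ends s w`).

* **The split** (`rbSum_eq_split`): on an atom `{C(w) = A}` with `s ∈ A` the events `bL`, `oL` are
  determined by `A` (`C(w) = C(s)` there), so its Rao–Blackwell term is `P(Q ∩ {C(w) = A} ∩ bL ∩ oL)`;
  summing, `rbSum bL oL = P(Q ∩ M ∩ bL ∩ oL) + rbSumFree bL oL`, where `rbSumFree` is the sum over
  the atoms `A ∌ s` (the (T+N)-part of MINE-A.md §40).
* **`Club`** (candidate row 2′RB-CLUB, cleared by `P(Q)`):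
  `P(Q ∩ bL) P(Q ∩ oL) / P(Q) ≤ P(Q ∩ M ∩ bL ∩ oL) + P(Q ∩ Mᶜ ∩ bL) P(Q ∩ Mᶜ ∩ oL) / P(Q ∩ Mᶜ)`,
  i.e. `μ(w,b,o ∈ C_s) + μ(w ∉ C_s) μ(b ∈ C_s | w ∉ C_s) μ(o ∈ C_s | w ∉ C_s) ≥ μ(b ∈ C_s) μ(o ∈ C_s)`;
  it is the Rao–Blackwell inequality for the coarse revealment «is `w ∈ C_s`; if so, are `b, o`».
* **`TNsame`** (the statement of the TN theorem of MINE-A.md §44, the row at an AVOIDED third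
  vertex, same form): `P(Q ∩ Mᶜ ∩ bL) P(Q ∩ Mᶜ ∩ oL) / P(Q ∩ Mᶜ) ≤ rbSumFree bL oL` — the
  (T+N)-part dominates the product of the avoided means (paper proof: the exploration of `C(w)`
  under `P(· | s ↮ {t, w})` is node-wise by positive association of `C_s` under avoidance).
* **`RBsame_of_club_of_TNsame`**: `Club → TNsame → RBsame` — row 2′RB (same form) reduces to
  the Rao–Blackwell-free inequality `Club` once the TN theorem is in the kernel.
-/

/-!
# Definitions for the «w ∈ C_s» split of row 2′RB and candidate row 2′RB-CLUB (blind cell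
PercRepro2, mine-a g7; MINE-A.md §43–§45, proofs/MINEA-CLUB.md)

Setting as in `RBDefs`: roots `s, t`, `Q = {s ↮ t}` (`Qst`), third vertex `w`, markers `b, o`,
`bL = {b ↔ s}`, `oL = {o ↔ s}`; `M = {s ↔ w} = {w ∈ C_s}` is `connEvent ends s w`.

* `rbSumFree X Y` — the Rao–Blackwell sum `rbSum` restricted to the atoms `{C(w) = A}` with `s ∉ A`
  (the (T+N)-part of MINE-A.md §40: the clusters of `w` that are not the cluster of `s`).
* `Club` — **candidate row 2′RB-CLUB** (cleared by `P(Q)`):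
  `P(Q ∩ bL) P(Q ∩ oL) / P(Q) ≤ P(Q ∩ M ∩ bL ∩ oL) + P(Q ∩ Mᶜ ∩ bL) P(Q ∩ Mᶜ ∩ oL) / P(Q ∩ Mᶜ)`,
  i.e. `μ(w,b,o ∈ C_s) + μ(w ∉ C_s) μ(b ∈ C_s | w ∉ C_s) μ(o ∈ C_s | w ∉ C_s) ≥ μ(b ∈ C_s) μ(o ∈ C_s)`
  — the Rao–Blackwell inequality for the coarse revealment «is `w ∈ C_s`; if so, are `b, o`»;
  `w = b` is BHK 1.3, `w = t` or `w` isolated is an equality (census 0 / 9,288 at `n ≤ 6`).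
  **`Club` is FALSE in general** (MINE-A.md §47, kit j219309): at `n = 7` it fails by `−1.33·10⁻⁵`
  (graph `c7_00536`, `(o,b,s,t,w) = (3,1,4,5,0)`, weights `k/256`) while row 2′RB holds there — the
  Rao–Blackwell covariance of `C(w)` under the avoidance law is necessary; `Club` survives on the
  census of KERNEL third vertices (`N(w) ⊆ {s,t,b,o}`: 0 / 97,680 at `n = 7, 8`, kit j219394).
* `TNsame` — the statement of the **TN theorem** (MINE-A.md §44, the row at an AVOIDED third
  vertex, same form): `P(Q ∩ Mᶜ ∩ bL) P(Q ∩ Mᶜ ∩ oL) / P(Q ∩ Mᶜ) ≤ rbSumFree bL oL` (paper proof: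
  the exploration of `C(w)` under `P(· | s ↮ {t, w})` is node-wise by positive association of `C_s`
  under avoidance).

`RBClub.lean` proves the split `rbSum bL oL = P(Q ∩ M ∩ bL ∩ oL) + rbSumFree bL oL` and
`Club → TNsame → RBsame`.
-/

namespace Summit.Ventures.PercRepro2

namespace RB

open scoped Classical

variable {V : Type*} {E : Type*} [Fintype E] [DecidableEq E] [Fintype V] [DecidableEq V]
  {R : Type*} [Field R] [LinearOrder R] [IsStrictOrderedRing R]

section Defs

variable (p : E → R) (ends : E → Sym2 V) (s t w : V)

/-- The Rao–Blackwell sum restricted to the atoms `{C(w) = A}` with `s ∉ A` (the (T+N)-part). -/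
noncomputable def rbSumFree (X Y : Set (Config E)) : R :=
  ∑ A : Set V, if s ∈ A then 0 else
    prob p (Qst ends s t ∩ clusterEvent ends w A ∩ X) *
        prob p (Qst ends s t ∩ clusterEvent ends w A ∩ Y) /
      prob p (Qst ends s t ∩ clusterEvent ends w A)

end Defs

section Rows

variable (p : E → R) (ends : E → Sym2 V) (o b s t w : V)

/-- **Row 2′RB-CLUB** (MINE-A.md §45), cleared by `P(Q)`: with `M = {s ↔ w}`,
`P(Q ∩ bL) P(Q ∩ oL) / P(Q) ≤ P(Q ∩ M ∩ bL ∩ oL) + P(Q ∩ Mᶜ ∩ bL) P(Q ∩ Mᶜ ∩ oL) / P(Q ∩ Mᶜ)`.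
FALSE for a general third vertex (MINE-A.md §47, `n = 7` witness); conjectured for kernel
third vertices (`N(w) ⊆ {s,t,b,o}`). -/
def Club : Prop :=
  prob p (Qst ends s t ∩ connEvent ends b s) * prob p (Qst ends s t ∩ connEvent ends o s) /
      prob p (Qst ends s t) ≤
    prob p (Qst ends s t ∩ connEvent ends s w ∩ connEvent ends b s ∩ connEvent ends o s) +
      prob p (Qst ends s t ∩ (connEvent ends s w)ᶜ ∩ connEvent ends b s) *
          prob p (Qst ends s t ∩ (connEvent ends s w)ᶜ ∩ connEvent ends o s) /
        prob p (Qst ends s t ∩ (connEvent ends s w)ᶜ)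

/-- **The TN statement** (MINE-A.md §44, same form): the (T+N)-part of the Rao–Blackwell sum
dominates the product of the means under the avoidance of `w`:
`P(Q ∩ Mᶜ ∩ bL) P(Q ∩ Mᶜ ∩ oL) / P(Q ∩ Mᶜ) ≤ rbSumFree bL oL`. -/
def TNsame : Prop :=
  prob p (Qst ends s t ∩ (connEvent ends s w)ᶜ ∩ connEvent ends b s) *
      prob p (Qst ends s t ∩ (connEvent ends s w)ᶜ ∩ connEvent ends o s) /
    prob p (Qst ends s t ∩ (connEvent ends s w)ᶜ) ≤
  rbSumFree p ends s t w (connEvent ends b s) (connEvent ends o s)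

end Rows

end RB

end Summit.Ventures.PercRepro2
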